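import Literature.NumberTheory.ConnesConsani2021.ArchimedeanSoninTrace
import Literature.NumberTheory.ConnesConsani2021.SoninProjection
import Literature.NumberTheory.LFunctions.WeilSemilocalQuadratic
import Literature.NumberTheory.LFunctions.WeilArchimedeanPositivityProofs
import Literature.NumberTheory.LFunctions.WeilExplicitArchTermProofs
import Literature.Analysis.OperatorTheory.LpDilation
import HarnessLib

/-!
# The semilocal Sonin space at `S = {∞, p}` and the Connes–Consani-shaped semilocal inequality — STATEMENT LAYER

Typed reproduction (definitions + elementary proved lemmas; NO new named fact, NO proof of any
inequality claimed) of the one object the Connes–Consani programme has put in print for a finite set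
of places `S = {∞, p}` that enters their proposed "conceptual" route to Weil positivity with a prime:
the **semilocal Sonin space** (A. Connes, C. Consani, H. Moscovici, *Zeta zeros and prolate wave
operators*, Ann. Funct. Anal. 15 (2024) = arXiv:2310.18423 [bib: `ConnesConsaniMoscovici2024`],
§4.6 Definition 4.5 and §4.7 Theorem 4.6), pulled back to the Hilbert space `L²(ℝ)_ev` of
A. Connes, C. Consani, *Weil positivity and trace formula, the archimedean place*, Selecta Math. 27
(2021) [bib: `ConnesConsani2021`] in which the tree's archimedean layer
(`ArchimedeanSoninTrace.lean`: `soninSpace`, `soninTraceForm`, `WeilArchPositivity_soninTrace`) lives.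
It is the object on which the cell `rh-explicit` (seats cc-s2-1/2, PLAN §1.3) builds, summit-side, "the
S = {∞,2} Connes–Consani operator statement"; this file records what is printed about it and nothing more.

## What is printed

* CCM 2024 §4.1–4.2 (arXiv pp. 12–13): `S ∋ ∞` finite, `𝔸_S = Π_{v∈S} ℚ_v`, `Γ = {± Π p^{n_p}}`,
  `X_S = 𝔸_S/Γ`, `C_S = GL₁(𝔸_S)/Γ`, the unitary `w_S : L²(X_S) → L²(C_S)` ([CMbook] Prop. 2.30), `K_S =
  ker Mod_S`; for `f ∈ L²(ℝ)^{ev}` the maps `η_S(f) = class of 1_{R_S} ⊗ f` and (Lemma after Def. 4.5,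
  (i)–(ii), p. 14) `θ_S(f) = class of σ_S ⊗ f`, `σ_p = ε₀ − p⁻¹ε₁`, with — eq. after Def. 4.5 (ii) —
  "`𝔽_μ(w_S(θ_S(f)))(s) = 𝔽_μ(w_∞(f))(s) × Π_{S∖{∞}} (1 − p^{−1/2−is})`", `w_∞(f)(u) = u^{1/2}f(u)`,
  `𝔽_μ` the Mellin–Plancherel transform `∫₀^∞ F(u)u^{−is}d*u`.
* CCM 2024 Definition 4.5 (p. 14): "Let `λ > 0`. The semilocal Sonin space `𝔖_λ(X_S, α)` is the subspace
  of the Hilbert space `L²(X_S)^{K_S}` defined as follows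
  `𝔖_λ(X_S,α) := {f ∈ L²(X_S)^{K_S} | f(x) = 0 & 𝔽_S f(x) = 0 ∀ x, |x| < λ}`
  where `𝔽_S` denotes the Fourier transform with respect to `α`."
* CCM 2024 Theorem 4.6 (p. 15): "Let `S ∋ ∞` be a finite set of places and `λ > 0`. Then the map `θ_S` is a
  hilbertian isomorphism of the Sonin spaces `θ_S : 𝔖_λ(ℝ, e_∞) → 𝔖_λ(X_S, α)`" ("hilbertian" =
  an isomorphism of topological vector spaces, footnote p. 5 — NOT unitary).
* CCM 2024 p. 3 (verbatim): "We expect that the use of such operator-theoretic tools in the semilocal case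
  opens a way to handle Weil's positivity as in [CCweil]. In fact, the operator theoretic aspect of the
  present paper provides a more precise strategy for addressing the semilocal Weil positivity by comparing
  the trace functional associated to the operator … with the Weil functional."  CC 2021 p. 3: "It is thus
  natural to implement this fundamental positivity in the semi-local framework applied to the finite set
  of places `{∞, 2, 3, …, p}` … Support(f) ⊂ (p⁻¹, p). In this paper we consider the simplest instance
  … the interval `(1/2, 2)` so that rational primes are not involved".  NO inequality with a prime is
  stated as a theorem or as a numbered conjecture anywhere in print (search record: cell `rh-explicit`,
  `HOME/cc-s2-1/MEMO.md` §3, 2026-08-21).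

## The pull-back (design, elementary)

`w_S` is unitary and `K_S`-invariants in `L²(C_S)` are functions of the module, so
`L²(X_S)^{K_S} ≅ L²(ℝ₊*, d*u) ≅ L²(ℝ)_ev` isometrically (`w_∞`, CC 2021 eq. (8): `⟨ξ|η⟩ = ∫₀^∞ ξ̄η dv =
∫ \overline{w_∞ξ} w_∞η d*u`).  Multiplication of `𝔽_μ(w_∞ ξ)(s)` by `p^{−1/2−is}` is `w_∞` of
`v ↦ p⁻¹ ξ(v/p)` (substitute `u = pv`), so THE PRINTED FORMULA FOR `θ_S` READS, on `L²(ℝ)_ev` and for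
`S = {∞, p}`:  `(θ_p ξ)(v) = ξ(v) − p⁻¹ ξ(p⁻¹ v)`, i.e. `θ_p = 1 − p^{−1/2} ϑ(p)` with CC's scaling unitary
`(ϑ(λ)ξ)(v) = λ^{−1/2}ξ(λ⁻¹v)` (CC 2021 eq. (40)) — a bounded operator with bounded inverse
`Σ_{k≥0} p^{−k/2}ϑ(p^k)` (`‖p^{−1/2}ϑ(p)‖ = p^{−1/2} < 1`).  By Theorem 4.6 the semilocal Sonin space,
pulled back along `w_S`, IS `θ_p(𝔖_λ(ℝ))`; we take this as the DEFINITION (`semilocalSoninSpace p α β :=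
(soninSpace α β).map (primeTwist p)`) and record Definition 4.5's intrinsic description as the dictionary:
`θ_p(𝔖) = {ξ : ξ = 0 on [−λ,λ], 𝔽_S ξ = 0 on [−λ,λ]}` with the pulled-back semilocal Fourier transform
`𝔽_S = θ_p 𝔽_{e_ℝ} θ_p⁻¹` (CCM 2024 §4.2, Lemma (iii), arXiv p. 12: `𝔽_S ∘ η_S = η_S ∘ 𝔽_{e_ℝ}`; its Mellin symbol is the
modulus-one ratio of local factors `(1 − p^{−1/2−is})/(1 − p^{−1/2+is})`, the tree's
`Summit…MotivicDoorSemilocalSymbol` anchors) — not needed for the statements and not constructed here.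
The dilation `ξ ↦ ξ(a ·)` on `L²(ℝ)` is the tree's `Literature.Analysis.OperatorTheory.lpDilation`.

## What is NOT in this file (and not in print)

The Connes–Consani-SHAPED inequality with a prime — "`W_∞(g∗g*) − W_p(g∗g*) ≥ Tr(ϑ(g) 𝔖_S ϑ(g)*)` for
`supp g ⊆ [−a, a]`, `f̂(i/2) = f̂(0) = 0`" and its finite-codimension variant — is NOT a printed statement
(CC 2021 p. 3 and CCM 2024 p. 3 name the step as a programme), hence not a Literature fact: the cell
`rh-explicit` keeps it summit-side (`HOME/cc-s2-1/S2-STATEMENT.md`, `SemilocalSoninIneqOn p a`, built on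
`semilocalSoninSpace` below).  What IS printed and proved here about its Weil side: on the `S = {∞,2}` window
`supp g ⊆ [−(log 3)/2, (log 3)/2]` only the prime `2` enters (CC 2023 §2.2), and the scalar inequality
`0 ≤ Re(W_∞(k) − W_2(k))`, `k = g ⋆ g̃`, `ĝ(1) = 0` — Connes' property `P(3)` (2026, §4.1), open in
print — follows from the tree's PROVED rung `weilPositivityOn_log_three_half`
(`semilocalWeilSide_re_nonneg_two`).

## Appended (same seat): `θ_p` is invertible, `𝔖_S(α, β)` is closed, the projection `𝔖_S` exists

`‖1 − θ_p‖ ≤ p^{-1/2} < 1` (`norm_one_sub_primeTwist_lt_one`, from the `L²` scaling law of `lpDilation`), hence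
`θ_p` is a unit (`primeTwistUnit`, `Units.oneSub`) and a continuous linear automorphism of `L²(ℝ)`
(`primeTwistEquiv`) — CCM 2024 Thm. 4.6's "hilbertian isomorphism" read on the ambient space; so
`semilocalSoninSpace p α β` is CLOSED (`isClosed_semilocalSoninSpace`, image of the closed `soninSpace`,
`SoninProjection.isClosed_soninSpace`), complete, and `semilocalSoninProjection p α β := starProjection` is the
orthogonal projection `𝔖_S` whose compression of the scaling action carries CCM's "trace functional".

## Appended (same seat, 2): Definition 4.5 pulled back — the intrinsic description, PROVED

`vanishOn γ`, `evenPart` (closed submodules); `1 − θ_p` = `ξ ↦ p⁻¹ξ(p⁻¹·)` preserves both, hence so do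
`θ_p` and `θ_p⁻¹ = Σ_k (1 − θ_p)^k` (`primeTwist_mem_of_mem`, `primeTwistEquiv_symm_mem`, Neumann series +
closedness); `semilocalFourier p := θ_p ∘ 𝓕 ∘ θ_p⁻¹` (the pulled-back `𝔽_S`); and
**`mem_semilocalSoninSpace_iff_vanish`**: `ξ ∈ 𝔖_S(α, β)` iff `ξ` is a.e. even, vanishes a.e. on `[−α, α]`
and `𝔽_S ξ` vanishes a.e. on `[−β, β]` — CCM 2024 Def. 4.5 verbatim (through `w_S`) ⟺ the image definition
(Thm. 4.6).

## Deliberately NOT here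

`L²(X_S)` itself, `w_S`, `𝔽_S`, the semilocal Hermite/prolate operators (CCM Thm. 4.1), the trace-class
theory, CC 2021 Thm. 4.7's `ε`, and anything asserting an inequality with a prime.
-/

noncomputable section

open _root_.MeasureTheory Complex Set
open scoped Real ComplexConjugate ENNReal

namespace Literature.NumberTheory.ConnesConsani2021

open Literature.NumberTheory.LFunctions Literature.Analysis.OperatorTheory

/-! ## The twist `θ_p = 1 − p^{-1/2} ϑ(p)` on `L²(ℝ)` -/

section Twist

variable (p : ℕ) [hp : Fact p.Prime]

/-- `p⁻¹ ≠ 0` in `ℝ` for a prime `p`. [folklore] -/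
private theorem primeTwist_ratio_ne_zero : ((p : ℝ)⁻¹) ≠ 0 :=
  inv_ne_zero (Nat.cast_ne_zero.mpr hp.out.ne_zero)

/-- **The map `θ_S` of CCM 2024 for `S = {∞, p}`, pulled back to `L²(ℝ)`**: `(θ_p ξ)(v) = ξ(v) − p⁻¹ ξ(p⁻¹ v)`
(`= ξ − p^{-1/2} ϑ(p) ξ` with CC's scaling unitary `ϑ`), the position-space form of the printed Mellin-line
formula `𝔽_μ(w_S(θ_S f))(s) = 𝔽_μ(w_∞ f)(s) · (1 − p^{−1/2−is})` (Lemma following Def. 4.5, (ii)).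
A bounded operator on `L²(ℝ) = Lp ℂ 2 volume` built from the tree's dilation `lpDilation`.
[cite: ConnesConsaniMoscovici2024, §4.6 Lemma after Def. 4.5 (ii) p. 14] -/
def primeTwist : Lp ℂ 2 (volume : Measure ℝ) →L[ℂ] Lp ℂ 2 (volume : Measure ℝ) :=
  1 - ((p : ℂ)⁻¹) •
    (lpDilation (V := ℝ) (F := ℂ) (p := (2 : ℝ≥0∞)) ((p : ℝ)⁻¹) (primeTwist_ratio_ne_zero p)
      ENNReal.ofNat_ne_top)

/-- `θ_p ξ = ξ − p⁻¹ ξ(p⁻¹ ·)` almost everywhere. [cite: ConnesConsaniMoscovici2024, §4.6 Lemma after Def. 4.5 (ii) p. 14] -/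
theorem primeTwist_coeFn (ξ : Lp ℂ 2 (volume : Measure ℝ)) :
    (primeTwist p ξ : ℝ → ℂ) =ᵐ[volume]
      fun v => (ξ : ℝ → ℂ) v - (p : ℂ)⁻¹ * (ξ : ℝ → ℂ) ((p : ℝ)⁻¹ * v) := by
  have hD := lpDilation_coeFn (V := ℝ) (F := ℂ) (p := (2 : ℝ≥0∞)) (primeTwist_ratio_ne_zero p)
    ENNReal.ofNat_ne_top ξ
  set D := lpDilation (V := ℝ) (F := ℂ) (p := (2 : ℝ≥0∞)) ((p : ℝ)⁻¹) (primeTwist_ratio_ne_zero p)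
    ENNReal.ofNat_ne_top with hDdef
  have h1 : primeTwist p ξ = ξ - (p : ℂ)⁻¹ • D ξ := by
    simp [primeTwist, hDdef]
  rw [h1]
  filter_upwards [Lp.coeFn_sub ξ ((p : ℂ)⁻¹ • D ξ), Lp.coeFn_smul ((p : ℂ)⁻¹) (D ξ), hD]
    with v hv hs hd
  rw [hv, Pi.sub_apply, hs, Pi.smul_apply, hd, smul_eq_mul]
  rfl

end Twist

/-! ## The semilocal Sonin space `𝔖_S(α, β)`, `S = {∞, p}`, on `L²(ℝ)_ev` -/

section Sonin

variable (p : ℕ) [hp : Fact p.Prime]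

/-- **The semilocal Sonin space for `S = {∞, p}`** (CCM 2024 Def. 4.5), pulled back to CC 2021's
`L²(ℝ)_ev` along the unitary `w_S`: by CCM 2024 Theorem 4.6 ("`θ_S` is a hilbertian isomorphism of the Sonin
spaces `𝔖_λ(ℝ, e_∞) → 𝔖_λ(X_S, α)`") it is the image of Sonin's space under `θ_p`, which we take as the
definition, with the two vanishing radii `α` (position) and `β` (semilocal Fourier side) kept separate as in
the tree's `soninSpace α β` (Def. 4.5 has `α = β = λ`).  Intrinsically (Def. 4.5 read through `w_S`):
`{ξ even : ξ = 0 a.e. on [−α, α], (θ_p 𝓕 θ_p⁻¹ ξ) = 0 a.e. on [−β, β]}` — see the module docstring.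
[cite: ConnesConsaniMoscovici2024, Def. 4.5 §4.6 p. 14; Thm. 4.6 §4.7 p. 15] -/
def semilocalSoninSpace (α β : ℝ) : Submodule ℂ (Lp ℂ 2 (volume : Measure ℝ)) :=
  (soninSpace α β).map (primeTwist p).toLinearMap

/-- Membership: `ξ ∈ 𝔖_S(α,β)` iff `ξ = θ_p η` for some `η` in Sonin's space `S(α, β)` (CCM 2024 Thm. 4.6, as a
definition here). [cite: ConnesConsaniMoscovici2024, Thm. 4.6 §4.7 p. 15] -/
theorem mem_semilocalSoninSpace_iff {α β : ℝ} {ξ : Lp ℂ 2 (volume : Measure ℝ)} :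
    ξ ∈ semilocalSoninSpace p α β ↔ ∃ η ∈ soninSpace α β, primeTwist p η = ξ :=
  Submodule.mem_map

/-- `θ_p` maps Sonin's space into the semilocal Sonin space (CCM 2024, Lemma after Def. 4.5 (i): "`θ_S(f)`
belongs to `𝔖_λ(X_S, α)`"; here by definition). [cite: ConnesConsaniMoscovici2024, §4.6 Lemma after Def. 4.5 (i) p. 14] -/
theorem primeTwist_mem_semilocalSoninSpace {α β : ℝ} {η : Lp ℂ 2 (volume : Measure ℝ)}
    (hη : η ∈ soninSpace α β) : primeTwist p η ∈ semilocalSoninSpace p α β :=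
  Submodule.mem_map_of_mem hη

/-- The position cut-off survives the twist: every `ξ ∈ 𝔖_S(α, β)` vanishes a.e. on `[−α, α]` (the first
half of Def. 4.5; CCM Lemma 4.2 (ii) "`η_S(P_λ) ⊂ P_λ^S`" is the same support computation). Reason:
`(θ_p η)(v) = η(v) − p⁻¹η(v/p)` and `|v/p| ≤ |v|`. [cite: ConnesConsaniMoscovici2024, Def. 4.5 §4.6 p. 14] -/
theorem ae_eq_zero_of_mem_semilocalSoninSpace {α β : ℝ} {ξ : Lp ℂ 2 (volume : Measure ℝ)}
    (hξ : ξ ∈ semilocalSoninSpace p α β) :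
    ∀ᵐ x : ℝ, x ∈ Icc (-α) α → (ξ : ℝ → ℂ) x = 0 := by
  obtain ⟨η, hη, rfl⟩ := (mem_semilocalSoninSpace_iff p).1 hξ
  obtain ⟨-, h2, -⟩ := (mem_soninSpace_iff α β η).1 hη
  have hp1 : (1 : ℝ) ≤ p := by exact_mod_cast hp.out.one_le
  have hdil : ∀ᵐ x : ℝ, (p : ℝ)⁻¹ * x ∈ Icc (-α) α → (η : ℝ → ℂ) ((p : ℝ)⁻¹ * x) = 0 := by
    have := (quasiMeasurePreserving_smul' (V := ℝ) (primeTwist_ratio_ne_zero p)).ae h2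
    simpa only [smul_eq_mul] using this
  have hpinv0 : 0 ≤ (p : ℝ)⁻¹ := inv_nonneg.2 (by positivity)
  have hpinv1 : (p : ℝ)⁻¹ ≤ 1 := inv_le_one_of_one_le₀ hp1
  filter_upwards [primeTwist_coeFn p η, h2, hdil] with x hx hzero hzero' hxI
  have hxabs : |x| ≤ α := abs_le.2 ⟨hxI.1, hxI.2⟩
  have hxI' : (p : ℝ)⁻¹ * x ∈ Icc (-α) α := by
    have h' : |(p : ℝ)⁻¹ * x| ≤ α := by
      rw [abs_mul, abs_of_nonneg hpinv0]
      calc (p : ℝ)⁻¹ * |x| ≤ 1 * |x| := by gcongr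
        _ = |x| := one_mul _
        _ ≤ α := hxabs
    exact ⟨(abs_le.1 h').1, (abs_le.1 h').2⟩
  rw [hx, hzero hxI, hzero' hxI', mul_zero, sub_zero]

end Sonin

/-! ## What the tree already PROVES on the `S = {∞, 2}` window (Connes' property `P(3)`) -/

/-- On the `S = {∞,2}` window `supp g ⊆ [−(log 3)/2, (log 3)/2]` only the prime `2` enters Weil's functional:
`Q(g) = W(g ⋆ g̃) = 2Re(ĝ(0)\overline{ĝ(1)}) + (W_∞(k) − W_2(k))`, `k = g ⋆ g̃` — the tree's `weilQuadratic`
versus the semilocal Weil side `W_∞ − W_2`. [cite: ConnesConsani2023, §2.1.2 (ψ(F) = F̂(i/2) + F̂(−i/2) − W_ℝ(F) − Σ_p W_p(F); on log 2 ≤ L < log 3 only p = 2 contributes, §2.2 p. 9)] -/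
theorem weilQuadratic_eq_polarTerm_add_semilocalWeilSide_two {g : ℝ → ℂ} (hg : IsWeilTest g)
    (hsupp : tsupport g ⊆ Icc (-(Real.log 3 / 2)) (Real.log 3 / 2)) :
    weilQuadratic g =
      ((2 * (weilMellin g 0 * conj (weilMellin g 1)).re : ℝ) : ℂ) +
        (archW (weilConv g (weilReflect g)) - weilSemilocalPrimeTerm {2} (weilConv g (weilReflect g))) := by
  have hΘ : IsWeilTest (weilConv g (weilReflect g)) := hg.weilConv hg.weilReflect
  have hS : ∀ n ≤ 2, IsPrimePow n → n.primeFactors ⊆ ({2} : Finset ℕ) := by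
    intro n hn hpp
    interval_cases n
    · exact absurd hpp not_isPrimePow_zero
    · exact absurd hpp not_isPrimePow_one
    · rw [Nat.prime_two.primeFactors]
  have h3 : ((2 : ℕ) : ℝ) + 1 = 3 := by norm_num
  have hsupp' : tsupport g ⊆
      Icc (-(Real.log (((2 : ℕ) : ℝ) + 1) / 2)) (Real.log (((2 : ℕ) : ℝ) + 1) / 2) := by
    rw [h3]; exact hsupp
  have key := weilSemilocalQuadratic_eq_weilQuadratic_of_forall hg hS hsupp'
  rw [← key]
  unfold weilSemilocalQuadratic weilSemilocalFunctional
  rw [weilPolarTerm_weilConv_weilReflect hg, archW, weilArchTermBombieri_eq_weilArchTerm_holds hΘ]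
  ring

/-- **The scalar shadow of "Theorem 1_S" at `S = {∞, 2}` is a theorem of the tree**: for every Weil test `g`
supported in `[−(log 3)/2, (log 3)/2]` with `f̂(i/2) = 0` one has `0 ≤ Re(W_∞(g∗g*) − W_2(g∗g*))` — because
this is `Re Q(g) ≥ 0`, i.e. the PROVED rung `weilPositivityOn_log_three_half` (kernel-certified, 2026-08-18),
in print open (Connes 2026, arXiv:2602.04022 §4.1: property `P(3)`).  So the content of any Connes–Consani-shaped
`S = {∞,2}` inequality on this window beyond the tree is exactly its Sonin-trace lower bound.
[cite: Connes2026Letter, §4.1 p. 17 (property P(n); P(2) = Yoshida's theorem is the printed frontier)] -/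
theorem semilocalWeilSide_re_nonneg_two {g : ℝ → ℂ} (hg : IsWeilTest g)
    (hsupp : tsupport g ⊆ Icc (-(Real.log 3 / 2)) (Real.log 3 / 2)) (h1 : mulFourier g (I / 2) = 0) :
    0 ≤ (archW (weilConv g (weilReflect g))
      - weilSemilocalPrimeTerm {2} (weilConv g (weilReflect g))).re := by
  rw [mulFourier_I_half] at h1
  have h := weilQuadratic_eq_polarTerm_add_semilocalWeilSide_two hg hsupp
  rw [h1, map_zero, mul_zero] at h
  simp only [zero_re, mul_zero, Complex.ofReal_zero, zero_add] at h
  rw [← h]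
  exact weilPositivityOn_log_three_half g hg hsupp


/-! ## `θ_p` is invertible and the semilocal Sonin space is closed (so `𝔖_S`, the orthogonal projection, exists)

CCM 2024 Theorem 4.6 calls `θ_S` a "hilbertian isomorphism"; on `L²(ℝ)` this is the elementary fact that
`θ_p = 1 − p^{-1/2}ϑ(p)` with `‖p^{-1/2}ϑ(p)‖ = p^{-1/2} < 1` is invertible (Neumann series
`Σ_k p^{-k/2}ϑ(p^k)`), so it maps the closed subspace `S(α, β)` (`isClosed_soninSpace`) onto a closed subspace. -/

section Closed

variable (p : ℕ) [hp : Fact p.Prime]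

/-- The `L²` scaling law for the dilation by `p⁻¹` on the line: `‖ξ(p⁻¹ ·)‖₂ = √p ‖ξ‖₂`.
[cite: ConnesConsaniMoscovici2024, §4.6 Lemma after Def. 4.5 (ii) p. 14] -/
theorem norm_lpDilation_inv_prime (ξ : Lp ℂ 2 (volume : Measure ℝ)) :
    ‖lpDilation (V := ℝ) (F := ℂ) (p := (2 : ℝ≥0∞)) ((p : ℝ)⁻¹) (primeTwist_ratio_ne_zero p)
        ENNReal.ofNat_ne_top ξ‖ = Real.sqrt p * ‖ξ‖ := by
  rw [norm_lpDilation_apply]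
  congr 1
  have hp0 : (0 : ℝ) ≤ p := Nat.cast_nonneg p
  rw [Module.finrank_self, pow_one, inv_inv, abs_of_nonneg hp0,
    show (1 / (2 : ℝ≥0∞)).toReal = (1 / 2 : ℝ) by simp, ← ENNReal.toReal_rpow,
    ENNReal.toReal_ofReal hp0, Real.sqrt_eq_rpow]

/-- `‖1 − θ_p‖ ≤ p^{-1/2} < 1`: the operator norm of `p^{-1/2}ϑ(p) = p⁻¹ D_{p⁻¹}`.
[cite: ConnesConsaniMoscovici2024, Thm. 4.6 §4.7 p. 15] -/
theorem norm_one_sub_primeTwist_lt_one :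
    ‖(1 : Lp ℂ 2 (volume : Measure ℝ) →L[ℂ] Lp ℂ 2 (volume : Measure ℝ)) - primeTwist p‖ < 1 := by
  have hp1 : (1 : ℝ) < p := by exact_mod_cast hp.out.one_lt
  have hp0 : (0 : ℝ) < p := by linarith
  have hsub : (1 : Lp ℂ 2 (volume : Measure ℝ) →L[ℂ] Lp ℂ 2 (volume : Measure ℝ)) - primeTwist p =
      ((p : ℂ)⁻¹) • lpDilation (V := ℝ) (F := ℂ) (p := (2 : ℝ≥0∞)) ((p : ℝ)⁻¹)
        (primeTwist_ratio_ne_zero p) ENNReal.ofNat_ne_top := by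
    simp [primeTwist]
  rw [hsub, norm_smul, norm_inv, Complex.norm_natCast]
  have hD : ‖lpDilation (V := ℝ) (F := ℂ) (p := (2 : ℝ≥0∞)) ((p : ℝ)⁻¹) (primeTwist_ratio_ne_zero p)
      ENNReal.ofNat_ne_top‖ ≤ Real.sqrt p :=
    ContinuousLinearMap.opNorm_le_bound _ (Real.sqrt_nonneg _)
      fun ξ => (norm_lpDilation_inv_prime p ξ).le
  calc (p : ℝ)⁻¹ * ‖lpDilation (V := ℝ) (F := ℂ) (p := (2 : ℝ≥0∞)) ((p : ℝ)⁻¹)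
          (primeTwist_ratio_ne_zero p) ENNReal.ofNat_ne_top‖
        ≤ (p : ℝ)⁻¹ * Real.sqrt p := by gcongr
    _ < 1 := by
        rw [inv_mul_lt_iff₀ hp0, mul_one]
        exact (Real.sqrt_lt' hp0).2 (by nlinarith)

/-- `θ_p` as a unit of the algebra of bounded operators on `L²(ℝ)` (`Units.oneSub`, Neumann series).
[cite: ConnesConsaniMoscovici2024, Thm. 4.6 §4.7 p. 15] -/
def primeTwistUnit : (Lp ℂ 2 (volume : Measure ℝ) →L[ℂ] Lp ℂ 2 (volume : Measure ℝ))ˣ :=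
  Units.oneSub ((1 : Lp ℂ 2 (volume : Measure ℝ) →L[ℂ] Lp ℂ 2 (volume : Measure ℝ)) - primeTwist p)
    (norm_one_sub_primeTwist_lt_one p)

/-- The unit's value is `θ_p`. [cite: ConnesConsaniMoscovici2024, Thm. 4.6 §4.7 p. 15] -/
theorem val_primeTwistUnit :
    ((primeTwistUnit p : (Lp ℂ 2 (volume : Measure ℝ) →L[ℂ] Lp ℂ 2 (volume : Measure ℝ))ˣ) :
      Lp ℂ 2 (volume : Measure ℝ) →L[ℂ] Lp ℂ 2 (volume : Measure ℝ)) = primeTwist p := by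
  rw [primeTwistUnit, Units.val_oneSub, sub_sub_cancel]

/-- **`θ_p` is a (bi-continuous, linear) isomorphism of `L²(ℝ)`** — CCM 2024's "hilbertian isomorphism"
read on the whole space. [cite: ConnesConsaniMoscovici2024, Thm. 4.6 §4.7 p. 15] -/
def primeTwistEquiv : Lp ℂ 2 (volume : Measure ℝ) ≃L[ℂ] Lp ℂ 2 (volume : Measure ℝ) :=
  ContinuousLinearEquiv.ofUnit (primeTwistUnit p)

/-- `primeTwistEquiv` acts as `θ_p`. [cite: ConnesConsaniMoscovici2024, Thm. 4.6 §4.7 p. 15] -/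
theorem primeTwistEquiv_apply (ξ : Lp ℂ 2 (volume : Measure ℝ)) :
    primeTwistEquiv p ξ = primeTwist p ξ := by
  change ((primeTwistUnit p : (Lp ℂ 2 (volume : Measure ℝ) →L[ℂ] Lp ℂ 2 (volume : Measure ℝ))ˣ) :
      Lp ℂ 2 (volume : Measure ℝ) →L[ℂ] Lp ℂ 2 (volume : Measure ℝ)) ξ = primeTwist p ξ
  rw [val_primeTwistUnit]

/-- **The semilocal Sonin space is closed** (image of the closed Sonin space `S(α,β)` under the
isomorphism `θ_p`; CCM 2024 Thm. 4.6). [cite: ConnesConsaniMoscovici2024, Thm. 4.6 §4.7 p. 15] -/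
theorem isClosed_semilocalSoninSpace (α β : ℝ) :
    IsClosed (semilocalSoninSpace p α β : Set (Lp ℂ 2 (volume : Measure ℝ))) := by
  have hset : (semilocalSoninSpace p α β : Set (Lp ℂ 2 (volume : Measure ℝ))) =
      primeTwistEquiv p '' (soninSpace α β : Set (Lp ℂ 2 (volume : Measure ℝ))) := by
    ext ξ
    simp only [semilocalSoninSpace, Submodule.map_coe, Set.mem_image, SetLike.mem_coe,
      ContinuousLinearMap.coe_coe, primeTwistEquiv_apply]
  rw [hset, ContinuousLinearEquiv.isClosed_image]
  exact isClosed_soninSpace α β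

/-- Hence complete, so the orthogonal projection onto it exists. [cite: ConnesConsaniMoscovici2024, Thm. 4.6 §4.7 p. 15] -/
instance completeSpace_semilocalSoninSpace (α β : ℝ) : CompleteSpace (semilocalSoninSpace p α β) :=
  (isClosed_semilocalSoninSpace p α β).completeSpace_coe

/-- **The orthogonal projection `𝔖_S` of `L²(ℝ)` onto the semilocal Sonin space** `𝔖_S(α, β)`,
`S = {∞, p}` — the operator whose compression of the scaling action carries the "trace functional" of
CCM 2024 p. 3 ("comparing the trace functional associated to the operator … with the Weil functional").
[cite: ConnesConsaniMoscovici2024, Def. 4.5 §4.6 p. 14; Introduction p. 3] -/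
def semilocalSoninProjection (α β : ℝ) :
    Lp ℂ 2 (volume : Measure ℝ) →L[ℂ] Lp ℂ 2 (volume : Measure ℝ) :=
  (semilocalSoninSpace p α β).starProjection

/-- `𝔖_S ξ ∈ 𝔖_S(α, β)` (the projection lands in the semilocal Sonin space of Def. 4.5). [cite: ConnesConsaniMoscovici2024, Def. 4.5 §4.6 p. 14] -/
theorem semilocalSoninProjection_mem (α β : ℝ) (ξ : Lp ℂ 2 (volume : Measure ℝ)) :
    semilocalSoninProjection p α β ξ ∈ semilocalSoninSpace p α β :=
  Submodule.starProjection_apply_mem _ ξ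

/-- `𝔖_S ξ = ξ ↔ ξ ∈ 𝔖_S(α, β)` (fixed vectors of the projection = the semilocal Sonin space of Def. 4.5). [cite: ConnesConsaniMoscovici2024, Def. 4.5 §4.6 p. 14] -/
theorem semilocalSoninProjection_eq_self_iff {α β : ℝ} {ξ : Lp ℂ 2 (volume : Measure ℝ)} :
    semilocalSoninProjection p α β ξ = ξ ↔ ξ ∈ semilocalSoninSpace p α β :=
  Submodule.starProjection_eq_self_iff

end Closed

/-! ## Definition 4.5 pulled back: the intrinsic description of `𝔖_S(α, β)` with the semilocal Fourier transform

We now PROVE that the image definition agrees with CCM 2024 Definition 4.5 read through `w_S`: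
`𝔖_S(α, β) = {ξ even : ξ = 0 a.e. on [−α, α], 𝔽_S ξ = 0 a.e. on [−β, β]}`, where the pulled-back semilocal
Fourier transform is `𝔽_S := θ_p ∘ 𝔽_{e_ℝ} ∘ θ_p⁻¹` (CCM 2024 §4.2, Lemma (iii): `𝔽_S ∘ η_S = η_S ∘ 𝔽_{e_ℝ}`, and
`θ_S` intertwines likewise).  The proof: `θ_p` and `θ_p⁻¹ = Σ_k (1 − θ_p)^k` (Neumann series) preserve
evenness and the vanishing on any symmetric interval `[−γ, γ]`, because `1 − θ_p` is `ξ ↦ p⁻¹ ξ(p⁻¹ ·)`. -/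

section Intrinsic

open FourierTransform
open scoped InnerProductSpace

variable (p : ℕ) [hp : Fact p.Prime]

/-- Pull-back of an a.e. equality along `x ↦ −x`. [folklore] -/
private theorem ae_eq_comp_neg'' {f g : ℝ → ℂ} (h : f =ᵐ[volume] g) :
    (fun x : ℝ => f (-x)) =ᵐ[volume] fun x : ℝ => g (-x) :=
  (Measure.measurePreserving_neg (volume : Measure ℝ)).quasiMeasurePreserving.ae_eq_comp h

/-- Functions of `L²(ℝ)` vanishing a.e. on `[−γ, γ]` (the condition "`f(x) = 0 ∀ x, |x| < λ`" of Def. 4.5), as a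
submodule. [cite: ConnesConsaniMoscovici2024, Def. 4.5 §4.6 p. 14] -/
def vanishOn (γ : ℝ) : Submodule ℂ (Lp ℂ 2 (volume : Measure ℝ)) where
  carrier := {ξ | ∀ᵐ x : ℝ, x ∈ Icc (-γ) γ → (ξ : ℝ → ℂ) x = 0}
  zero_mem' := by
    simp only [Set.mem_setOf_eq]
    filter_upwards [Lp.coeFn_zero ℂ 2 (volume : Measure ℝ)] with x hx _
    rw [hx]; rfl
  add_mem' := by
    intro ξ η hξ hη
    simp only [Set.mem_setOf_eq] at hξ hη ⊢
    filter_upwards [Lp.coeFn_add ξ η, hξ, hη] with x hx e1 e2 hxI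
    rw [hx, Pi.add_apply, e1 hxI, e2 hxI, add_zero]
  smul_mem' := by
    intro c ξ hξ
    simp only [Set.mem_setOf_eq] at hξ ⊢
    filter_upwards [Lp.coeFn_smul c ξ, hξ] with x hx e1 hxI
    rw [hx, Pi.smul_apply, e1 hxI, smul_zero]

/-- Membership in `vanishOn γ`. [cite: ConnesConsaniMoscovici2024, Def. 4.5 §4.6 p. 14] -/
theorem mem_vanishOn_iff {γ : ℝ} {ξ : Lp ℂ 2 (volume : Measure ℝ)} :
    ξ ∈ vanishOn γ ↔ ∀ᵐ x : ℝ, x ∈ Icc (-γ) γ → (ξ : ℝ → ℂ) x = 0 :=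
  Iff.rfl

/-- `vanishOn γ` is closed in `L²(ℝ)` (intersection of the kernels of `ξ ↦ ⟪𝟙_A, ξ⟫`, `A ⊆ [−γ, γ]` measurable).
Same argument as `SoninProjection.isClosed_soninSpace`. [cite: ConnesConsaniMoscovici2024, Def. 4.5 §4.6 p. 14] -/
theorem isClosed_vanishOn (γ : ℝ) : IsClosed (vanishOn γ : Set (Lp ℂ 2 (volume : Measure ℝ))) := by
  have hI : MeasurableSet (Icc (-γ) γ) := measurableSet_Icc
  have hfin : ∀ A : Set ℝ, A ⊆ Icc (-γ) γ → volume A ≠ ∞ := fun A hA =>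
    (lt_of_le_of_lt (measure_mono hA) measure_Icc_lt_top).ne
  have key : (vanishOn γ : Set (Lp ℂ 2 (volume : Measure ℝ))) =
      ⋂ (A : Set ℝ) (hA : MeasurableSet A) (hAI : A ⊆ Icc (-γ) γ),
        {ξ : Lp ℂ 2 (volume : Measure ℝ) |
          ⟪indicatorConstLp 2 hA (hfin A hAI) (1 : ℂ), ξ⟫_ℂ = 0} := by
    ext ξ
    simp only [SetLike.mem_coe, mem_vanishOn_iff, Set.mem_setOf_eq, Set.mem_iInter]
    constructor
    · intro h A hA hAI
      rw [L2.inner_indicatorConstLp_one]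
      refine setIntegral_eq_zero_of_ae_eq_zero ?_
      filter_upwards [h] with x hx hxA using hx (hAI hxA)
    · intro h
      haveI : IsFiniteMeasure ((volume : Measure ℝ).restrict (Icc (-γ) γ)) :=
        ⟨by rw [Measure.restrict_apply_univ]; exact measure_Icc_lt_top⟩
      have hint : Integrable (ξ : ℝ → ℂ) ((volume : Measure ℝ).restrict (Icc (-γ) γ)) :=
        ((Lp.memLp ξ).restrict (Icc (-γ) γ)).integrable one_le_two
      have hz := hint.ae_eq_zero_of_forall_setIntegral_eq_zero (fun s hs _ => by
        rw [Measure.restrict_restrict hs]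
        have := h (s ∩ Icc (-γ) γ) (hs.inter hI) inter_subset_right
        rwa [L2.inner_indicatorConstLp_one] at this)
      rw [Filter.EventuallyEq, ae_restrict_iff' hI] at hz
      filter_upwards [hz] with x hx hxI using hx hxI
  rw [key]
  exact isClosed_iInter fun A => isClosed_iInter fun hA => isClosed_iInter fun hAI =>
    isClosed_eq (continuous_const.inner continuous_id) continuous_const

/-- A.e.-even functions of `L²(ℝ)` (`L²(ℝ)_ev`), as a submodule. [cite: ConnesConsaniMoscovici2024, Def. 4.5 §4.6 p. 14] -/
def evenPart : Submodule ℂ (Lp ℂ 2 (volume : Measure ℝ)) where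
  carrier := {ξ | ∀ᵐ x : ℝ, (ξ : ℝ → ℂ) (-x) = (ξ : ℝ → ℂ) x}
  zero_mem' := by
    simp only [Set.mem_setOf_eq]
    have h0 := Lp.coeFn_zero ℂ 2 (volume : Measure ℝ)
    filter_upwards [h0, ae_eq_comp_neg'' h0] with x hx hx'
    rw [hx', hx, Pi.zero_apply, Pi.zero_apply]
  add_mem' := by
    intro ξ η hξ hη
    simp only [Set.mem_setOf_eq] at hξ hη ⊢
    have ha := Lp.coeFn_add ξ η
    filter_upwards [ha, ae_eq_comp_neg'' ha, hξ, hη] with x hx hx' e1 e2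
    rw [hx', hx, Pi.add_apply, Pi.add_apply, e1, e2]
  smul_mem' := by
    intro c ξ hξ
    simp only [Set.mem_setOf_eq] at hξ ⊢
    have hs := Lp.coeFn_smul c ξ
    filter_upwards [hs, ae_eq_comp_neg'' hs, hξ] with x hx hx' e1
    rw [hx', hx, Pi.smul_apply, Pi.smul_apply, e1]

/-- Membership in `evenPart`. [cite: ConnesConsaniMoscovici2024, Def. 4.5 §4.6 p. 14] -/
theorem mem_evenPart_iff {ξ : Lp ℂ 2 (volume : Measure ℝ)} :
    ξ ∈ evenPart ↔ ∀ᵐ x : ℝ, (ξ : ℝ → ℂ) (-x) = (ξ : ℝ → ℂ) x :=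
  Iff.rfl

/-- Reflection as a linear isometry of `L²(ℝ)`. [folklore] -/
private def reflectOp : Lp ℂ 2 (volume : Measure ℝ) →ₗᵢ[ℂ] Lp ℂ 2 (volume : Measure ℝ) :=
  Lp.compMeasurePreservingₗᵢ ℂ (fun x : ℝ => -x) (Measure.measurePreserving_neg (volume : Measure ℝ))

/-- `evenPart` is closed (fixed space of the reflection isometry; as in `SoninProjection`).
[cite: ConnesConsaniMoscovici2024, Def. 4.5 §4.6 p. 14] -/
theorem isClosed_evenPart : IsClosed (evenPart : Set (Lp ℂ 2 (volume : Measure ℝ))) := by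
  have hcoe : ∀ ξ : Lp ℂ 2 (volume : Measure ℝ),
      (reflectOp ξ : ℝ → ℂ) =ᵐ[volume] fun x => (ξ : ℝ → ℂ) (-x) := fun ξ =>
    Lp.coeFn_compMeasurePreserving ξ (Measure.measurePreserving_neg (volume : Measure ℝ))
  have : (evenPart : Set (Lp ℂ 2 (volume : Measure ℝ))) = {ξ | reflectOp ξ = ξ} := by
    ext ξ
    simp only [SetLike.mem_coe, mem_evenPart_iff, Set.mem_setOf_eq]
    constructor
    · intro h
      exact Lp.ext ((hcoe ξ).trans h)
    · intro h
      have h1 := hcoe ξ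
      rw [h] at h1
      filter_upwards [h1] with x hx
      exact hx.symm
  rw [this]
  exact isClosed_eq reflectOp.continuous continuous_id

/-- Sonin's space is `evenPart ⊓ vanishOn α ⊓ 𝓕⁻¹(vanishOn β)` — bookkeeping. [cite: ConnesConsani2021, Def. 4.4 §4 p. 16] -/
theorem mem_soninSpace_iff' {α β : ℝ} {ξ : Lp ℂ 2 (volume : Measure ℝ)} :
    ξ ∈ soninSpace α β ↔ ξ ∈ evenPart ∧ ξ ∈ vanishOn α ∧
      (𝓕 ξ : Lp ℂ 2 (volume : Measure ℝ)) ∈ vanishOn β :=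
  Iff.rfl

/-- `1 − θ_p` is `ξ ↦ p⁻¹ ξ(p⁻¹ ·)` a.e. [cite: ConnesConsaniMoscovici2024, §4.6 Lemma after Def. 4.5 (ii) p. 14] -/
theorem coeFn_one_sub_primeTwist (ξ : Lp ℂ 2 (volume : Measure ℝ)) :
    ((((1 : Lp ℂ 2 (volume : Measure ℝ) →L[ℂ] Lp ℂ 2 (volume : Measure ℝ)) - primeTwist p) ξ :
        Lp ℂ 2 (volume : Measure ℝ)) : ℝ → ℂ) =ᵐ[volume]
      fun v => (p : ℂ)⁻¹ * (ξ : ℝ → ℂ) ((p : ℝ)⁻¹ * v) := by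
  rw [show ((1 : Lp ℂ 2 (volume : Measure ℝ) →L[ℂ] Lp ℂ 2 (volume : Measure ℝ)) - primeTwist p) ξ =
      ξ - primeTwist p ξ from rfl]
  filter_upwards [Lp.coeFn_sub ξ (primeTwist p ξ), primeTwist_coeFn p ξ] with v hv hθ
  rw [hv, Pi.sub_apply, hθ]
  ring

/-- `1 − θ_p` preserves vanishing on `[−γ, γ]` (`|p⁻¹ v| ≤ |v|`). [cite: ConnesConsaniMoscovici2024, Def. 4.5 §4.6 p. 14] -/
theorem one_sub_primeTwist_mem_vanishOn {γ : ℝ} {ξ : Lp ℂ 2 (volume : Measure ℝ)} (hξ : ξ ∈ vanishOn γ) :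
    ((1 : Lp ℂ 2 (volume : Measure ℝ) →L[ℂ] Lp ℂ 2 (volume : Measure ℝ)) - primeTwist p) ξ ∈ vanishOn γ := by
  rw [mem_vanishOn_iff] at hξ ⊢
  have hp1 : (1 : ℝ) ≤ p := by exact_mod_cast hp.out.one_le
  have hpinv0 : 0 ≤ (p : ℝ)⁻¹ := inv_nonneg.2 (by positivity)
  have hpinv1 : (p : ℝ)⁻¹ ≤ 1 := inv_le_one_of_one_le₀ hp1
  have hdil : ∀ᵐ x : ℝ, (p : ℝ)⁻¹ * x ∈ Icc (-γ) γ → (ξ : ℝ → ℂ) ((p : ℝ)⁻¹ * x) = 0 := by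
    have := (quasiMeasurePreserving_smul' (V := ℝ) (primeTwist_ratio_ne_zero p)).ae hξ
    simpa only [smul_eq_mul] using this
  filter_upwards [coeFn_one_sub_primeTwist p ξ, hdil] with x hx hzero hxI
  have hxabs : |x| ≤ γ := abs_le.2 ⟨hxI.1, hxI.2⟩
  have h' : |(p : ℝ)⁻¹ * x| ≤ γ := by
    rw [abs_mul, abs_of_nonneg hpinv0]
    calc (p : ℝ)⁻¹ * |x| ≤ 1 * |x| := by gcongr
      _ = |x| := one_mul _
      _ ≤ γ := hxabs
  rw [hx, hzero ⟨(abs_le.1 h').1, (abs_le.1 h').2⟩, mul_zero]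

/-- `1 − θ_p` preserves evenness. [cite: ConnesConsaniMoscovici2024, Def. 4.5 §4.6 p. 14] -/
theorem one_sub_primeTwist_mem_evenPart {ξ : Lp ℂ 2 (volume : Measure ℝ)} (hξ : ξ ∈ evenPart) :
    ((1 : Lp ℂ 2 (volume : Measure ℝ) →L[ℂ] Lp ℂ 2 (volume : Measure ℝ)) - primeTwist p) ξ ∈ evenPart := by
  rw [mem_evenPart_iff] at hξ ⊢
  have hform := coeFn_one_sub_primeTwist p ξ
  have hform' := ae_eq_comp_neg'' hform
  have hdil : ∀ᵐ x : ℝ, (ξ : ℝ → ℂ) (-((p : ℝ)⁻¹ * x)) = (ξ : ℝ → ℂ) ((p : ℝ)⁻¹ * x) := by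
    have := (quasiMeasurePreserving_smul' (V := ℝ) (primeTwist_ratio_ne_zero p)).ae hξ
    simpa only [smul_eq_mul] using this
  filter_upwards [hform, hform', hdil] with x hx hx' he
  rw [hx', hx]
  simp only [mul_neg, he]

/-- Powers of `1 − θ_p` preserve any submodule that `1 − θ_p` preserves. [folklore] -/
private theorem pow_one_sub_primeTwist_mem {V : Submodule ℂ (Lp ℂ 2 (volume : Measure ℝ))}
    (hV : ∀ ξ ∈ V, ((1 : Lp ℂ 2 (volume : Measure ℝ) →L[ℂ] Lp ℂ 2 (volume : Measure ℝ)) - primeTwist p) ξ ∈ V)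
    {ξ : Lp ℂ 2 (volume : Measure ℝ)} (hξ : ξ ∈ V) (n : ℕ) :
    (((1 : Lp ℂ 2 (volume : Measure ℝ) →L[ℂ] Lp ℂ 2 (volume : Measure ℝ)) - primeTwist p) ^ n) ξ ∈ V := by
  induction n with
  | zero => simpa using hξ
  | succ n ih =>
    rw [pow_succ']
    exact hV _ ih

/-- `θ_p⁻¹ = Σ_k (1 − θ_p)^k` preserves every CLOSED submodule preserved by `1 − θ_p` (Neumann series).
[cite: ConnesConsaniMoscovici2024, Thm. 4.6 §4.7 p. 15] -/
theorem primeTwistEquiv_symm_mem {V : Submodule ℂ (Lp ℂ 2 (volume : Measure ℝ))}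
    (hVc : IsClosed (V : Set (Lp ℂ 2 (volume : Measure ℝ))))
    (hV : ∀ ξ ∈ V, ((1 : Lp ℂ 2 (volume : Measure ℝ) →L[ℂ] Lp ℂ 2 (volume : Measure ℝ)) - primeTwist p) ξ ∈ V)
    {ξ : Lp ℂ 2 (volume : Measure ℝ)} (hξ : ξ ∈ V) :
    (primeTwistEquiv p).symm ξ ∈ V := by
  set t : Lp ℂ 2 (volume : Measure ℝ) →L[ℂ] Lp ℂ 2 (volume : Measure ℝ) := 1 - primeTwist p with ht
  have hsum0 : HasSum (fun n : ℕ => t ^ n) (∑' n : ℕ, t ^ n) :=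
    (summable_geometric_of_norm_lt_one (norm_one_sub_primeTwist_lt_one p)).hasSum
  have hsum := hsum0.mapL (ContinuousLinearMap.apply ℂ (Lp ℂ 2 (volume : Measure ℝ)) ξ)
  simp only [ContinuousLinearMap.apply_apply] at hsum
  have hinv : (primeTwistEquiv p).symm ξ = (∑' n : ℕ, t ^ n) ξ := rfl
  rw [hinv]
  exact hVc.mem_of_tendsto hsum.tendsto_sum_nat
    (Filter.Eventually.of_forall fun N => V.sum_mem fun n _ => pow_one_sub_primeTwist_mem p hV hξ n)

/-- `θ_p` preserves every submodule preserved by `1 − θ_p`. [cite: ConnesConsaniMoscovici2024, Thm. 4.6 §4.7 p. 15] -/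
theorem primeTwist_mem_of_mem {V : Submodule ℂ (Lp ℂ 2 (volume : Measure ℝ))}
    (hV : ∀ ξ ∈ V, ((1 : Lp ℂ 2 (volume : Measure ℝ) →L[ℂ] Lp ℂ 2 (volume : Measure ℝ)) - primeTwist p) ξ ∈ V)
    {ξ : Lp ℂ 2 (volume : Measure ℝ)} (hξ : ξ ∈ V) : primeTwist p ξ ∈ V := by
  have h : primeTwist p ξ = ξ - ((1 : Lp ℂ 2 (volume : Measure ℝ) →L[ℂ] Lp ℂ 2 (volume : Measure ℝ))
      - primeTwist p) ξ := by
    rw [show ((1 : Lp ℂ 2 (volume : Measure ℝ) →L[ℂ] Lp ℂ 2 (volume : Measure ℝ)) - primeTwist p) ξ =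
      ξ - primeTwist p ξ from rfl, sub_sub_cancel]
  rw [h]
  exact V.sub_mem hξ (hV _ hξ)

/-- **The pulled-back semilocal Fourier transform** `𝔽_S := θ_p ∘ 𝔽_{e_ℝ} ∘ θ_p⁻¹` on `L²(ℝ)`, `S = {∞, p}`
(the conjugate of Mathlib's `L²` Fourier transform by the isomorphism `θ_p`; CCM 2024 §4.2 Lemma (iii):
`𝔽_S ∘ η_S = η_S ∘ 𝔽_{e_ℝ}`, likewise for `θ_S`).  Its Mellin symbol is the modulus-one ratio of local
factors `(1 − p^{−1/2−is})/(1 − p^{−1/2+is})`; unitarity is not needed here and not proved.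
[cite: ConnesConsaniMoscovici2024, §4.2 Lemma (iii) p. 12; Def. 4.5 §4.6 p. 14] -/
def semilocalFourier : Lp ℂ 2 (volume : Measure ℝ) →L[ℂ] Lp ℂ 2 (volume : Measure ℝ) :=
  ((primeTwistEquiv p : Lp ℂ 2 (volume : Measure ℝ) →L[ℂ] Lp ℂ 2 (volume : Measure ℝ)).comp
    ((Lp.fourierTransformₗᵢ ℝ ℂ).toContinuousLinearEquiv :
      Lp ℂ 2 (volume : Measure ℝ) →L[ℂ] Lp ℂ 2 (volume : Measure ℝ))).comp
    ((primeTwistEquiv p).symm : Lp ℂ 2 (volume : Measure ℝ) →L[ℂ] Lp ℂ 2 (volume : Measure ℝ))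

/-- `𝔽_S ξ = θ_p (𝓕 (θ_p⁻¹ ξ))`. [cite: ConnesConsaniMoscovici2024, §4.2 Lemma (iii) p. 12] -/
theorem semilocalFourier_apply (ξ : Lp ℂ 2 (volume : Measure ℝ)) :
    semilocalFourier p ξ =
      primeTwist p ((𝓕 ((primeTwistEquiv p).symm ξ) : Lp ℂ 2 (volume : Measure ℝ))) := by
  rw [← primeTwistEquiv_apply]
  rfl

/-- **CCM 2024 Definition 4.5 = the image definition (Theorem 4.6 pulled back), PROVED**:
`ξ ∈ 𝔖_S(α, β)` iff `ξ` is a.e. even, `ξ = 0` a.e. on `[−α, α]` and `𝔽_S ξ = 0` a.e. on `[−β, β]`.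
[cite: ConnesConsaniMoscovici2024, Def. 4.5 §4.6 p. 14; Thm. 4.6 §4.7 p. 15] -/
theorem mem_semilocalSoninSpace_iff_vanish {α β : ℝ} {ξ : Lp ℂ 2 (volume : Measure ℝ)} :
    ξ ∈ semilocalSoninSpace p α β ↔
      (∀ᵐ x : ℝ, (ξ : ℝ → ℂ) (-x) = (ξ : ℝ → ℂ) x) ∧
      (∀ᵐ x : ℝ, x ∈ Icc (-α) α → (ξ : ℝ → ℂ) x = 0) ∧
      (∀ᵐ x : ℝ, x ∈ Icc (-β) β →
        ((semilocalFourier p ξ : Lp ℂ 2 (volume : Measure ℝ)) : ℝ → ℂ) x = 0) := by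
  -- abbreviations
  have hVe := fun ξ (h : ξ ∈ evenPart) => one_sub_primeTwist_mem_evenPart p h
  have hVa : ∀ γ : ℝ, ∀ ξ ∈ vanishOn γ, ((1 : Lp ℂ 2 (volume : Measure ℝ) →L[ℂ]
      Lp ℂ 2 (volume : Measure ℝ)) - primeTwist p) ξ ∈ vanishOn γ :=
    fun γ ξ h => one_sub_primeTwist_mem_vanishOn p h
  set η := (primeTwistEquiv p).symm ξ with hη
  have hξη : primeTwist p η = ξ := by
    rw [← primeTwistEquiv_apply]; exact (primeTwistEquiv p).apply_symm_apply ξ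
  have hF : semilocalFourier p ξ = primeTwist p ((𝓕 η : Lp ℂ 2 (volume : Measure ℝ))) :=
    semilocalFourier_apply p ξ
  change ξ ∈ semilocalSoninSpace p α β ↔
    ξ ∈ evenPart ∧ ξ ∈ vanishOn α ∧ semilocalFourier p ξ ∈ vanishOn β
  constructor
  · intro h
    obtain ⟨η', hη'S, hη'eq⟩ := (mem_semilocalSoninSpace_iff p).1 h
    have hηη' : η' = η := by
      apply (primeTwistEquiv p).injective
      rw [primeTwistEquiv_apply, hη'eq, primeTwistEquiv_apply, hξη]
    rw [hηη'] at hη'S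
    obtain ⟨he, hv, hf⟩ := (mem_soninSpace_iff' ).1 hη'S
    refine ⟨?_, ?_, ?_⟩
    · rw [← hξη]; exact primeTwist_mem_of_mem p hVe he
    · rw [← hξη]; exact primeTwist_mem_of_mem p (hVa α) hv
    · rw [hF]; exact primeTwist_mem_of_mem p (hVa β) hf
  · rintro ⟨he, hv, hf⟩
    refine (mem_semilocalSoninSpace_iff p).2 ⟨η, ?_, hξη⟩
    refine (mem_soninSpace_iff' ).2 ⟨?_, ?_, ?_⟩
    · exact primeTwistEquiv_symm_mem p isClosed_evenPart hVe he
    · exact primeTwistEquiv_symm_mem p (isClosed_vanishOn α) (hVa α) hv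
    · have : (𝓕 η : Lp ℂ 2 (volume : Measure ℝ)) = (primeTwistEquiv p).symm (semilocalFourier p ξ) := by
        rw [hF, ← primeTwistEquiv_apply, ContinuousLinearEquiv.symm_apply_apply]
      rw [this]
      exact primeTwistEquiv_symm_mem p (isClosed_vanishOn β) (hVa β) hf

end Intrinsic

end Literature.NumberTheory.ConnesConsani2021
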